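import Literature.AlgebraicGeometry.Motives.MixedHodgeStructureCatHodgePolynomial
import Literature.AlgebraicGeometry.Motives.MixedHodgeStructureCatWeightTruncationGr
import Literature.AlgebraicGeometry.Motives.MixedHodgeStructureCatWeightGradedObjectHodge
import Literature.AlgebraicGeometry.Motives.MixedHodgeStructureCatWeightGradedObjectSplitOverQ
import Literature.AlgebraicGeometry.Motives.MixedHodgeStructureCatWeightSerreClasses
import HarnessLib

/-!
# The weight polynomial `P_W(X) = Σ_k dim Gr^W_k X · t^k = E(X; t, t)` and the Hodge–Deligne polynomial along the weight filtration

Layer `Literature/AlgebraicGeometry/Motives` (lane `lit-hodgefound`), continuing g45-#21 (`hodgePolynomial X = E(X) ∈ ℤ[ℤ × ℤ]`).  Specialising `u = v = t` gives the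
**weight (Poincaré) polynomial `P_W(X)(t) := E(X)(t, t) = Σ_k (dim_ℚ Gr^W_k X) t^k ∈ ℤ[ℤ]`** (Deligne, *Hodge II* 2.3.1, 2.3.7: the weights of a MHS are the `k` with `Gr^W_k ≠ 0`;
El Zein–Lê Prop. 3.2.19: `Gr^W_k H_ℂ = ⊕_{p+q=k} I^{p,q}`), and the tree's weight vocabulary on `MixedHodgeStructureCat` (`IsWeight`, `weightsIn`, `IsPure`, `weightFunctor`,
`weightQuotFunctor`, `grTotal`) is READ OFF the polynomials:

* §1 `weightPolynomial X` and **`coeff_weightPolynomial : [t^k] P_W(X) = dim Gr^W_k X`** (`= Σ_{p+q=k} h^{p,q}(X)`), `Σ_k [t^k] P_W = dim X`;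
* §2 **`isWeight_iff_coeff_weightPolynomial_ne_zero`**, **`weightsIn_iff_support_weightPolynomial_subset`**, **`isPure_iff_weightPolynomial_eq_single`**;
* §3 `P_W` is additive on short exact sequences and **multiplicative** (`weightPolynomial_tensorObj`), `P_W(X^∨)(t) = P_W(X)(t⁻¹)`, `P_W(X(j)) = t^{−2j} P_W(X)`, `P_W(ℚ(j)) = t^{−2j}`;
* §4 `E` along the weight filtration: **`coeff_hodgePolynomial_weightFunctor_obj`** (`E(W_k X)` = the part `p+q ≤ k` of `E(X)`), **`coeff_hodgePolynomial_weightQuotFunctor_obj`**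
  (`E(X/W_k X)` = the part `p+q > k`), and **`hodgePolynomial_grTotal_obj : E(⊕_{k∈s} Gr^W_k X) = E(X)`** — `E` only sees the associated weight-graded object.

Everything is PROVED; no named fact, no instance, no notation.  Data: `weightPolynomial`.

Sources, verbatim (through the tree's files).  P. Deligne, *Théorie de Hodge II* (1971) [DeligneHodgeII1971], 2.3.1 (`Gr^W_n`), 2.3.7, 1.1.12, 2.1.13.  E. Cattani et al. (eds.), *Hodge Theory*
(2014) [CattaniElZeinGriffithsLe2014], Prop. 3.2.19 (`W_n H_ℂ = ⊕_{p+q≤n} I^{p,q}`, hence `dim Gr^W_k = Σ_{p+q=k} h^{p,q}`), Cor. 3.2.21 (ii), Cor. 3.2.33, §3.2.2.6–7.  S. Yokura,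
[Yokura2011MotivicCharacteristicClasses] §2 Rem. 2-9 p. 386 (the Hodge–Deligne polynomial; the specialisations `(u, v) = (t, t)`, `(−1, −1)`).

## Main results

* §1 **`weightPolynomial`**, `finrank_grW_eq_sum_hodgeNumber`, **`coeff_weightPolynomial`**, `sum_coeff_weightPolynomial`.
* §2 **`isWeight_iff_coeff_weightPolynomial_ne_zero`**, **`weightsIn_iff_support_weightPolynomial_subset`**, **`isPure_iff_weightPolynomial_eq_single`**.
* §3 `weightPolynomial_eq_of_iso`, **`weightPolynomial_eq_add_of_shortExact`**, **`weightPolynomial_tensorObj`**, `weightPolynomial_unitObj`, `weightPolynomial_dual`,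
  `weightPolynomial_tateTwist`, `weightPolynomial_tateObj`.
* §4 **`coeff_hodgePolynomial_weightFunctor_obj`**, **`coeff_hodgePolynomial_weightQuotFunctor_obj`**, **`hodgePolynomial_grTotal_obj`**, `weightPolynomial_grTotal_obj`.

## References

* [DeligneHodgeII1971] P. Deligne, Théorie de Hodge II, Publ. Math. IHÉS 40 (1971), 2.3.1, 2.3.7, 1.1.12, 2.1.13.
* [CattaniElZeinGriffithsLe2014] E. Cattani et al. (eds.), Hodge Theory, Princeton Math. Notes 49 (2014), Prop. 3.2.19, Cor. 3.2.21 (ii), Cor. 3.2.33, §3.2.2.6–7.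
* [Yokura2011MotivicCharacteristicClasses] S. Yokura, Motivic characteristic classes, in Topology of Stratified Spaces, MSRI Publ. 58, CUP (2011), §2 Rem. 2-9, p. 386.

## Provenance

Lane `lit-hodgefound` (summit `HodgeConjecture`), seat `lit-hodgefound-p36` (literature-prover, generation 45, row g45-#22).
-/

noncomputable section

open CategoryTheory CategoryTheory.Limits

namespace Literature.AlgebraicGeometry.Motives

universe u

namespace MixedHodgeStructureCat

variable (X Y : MixedHodgeStructureCat.{u}) [Module.Finite ℚ X] [Module.Finite ℚ Y]

/-! ## §1 The weight polynomial -/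

/-- The total-degree map `(p, q) ↦ p + q : ℤ × ℤ →+ ℤ` (the specialisation `u = v = t`). [cite: Yokura2011MotivicCharacteristicClasses, §2 Rem. 2-9 (p. 386)] -/
abbrev totalDegree : ℤ × ℤ →+ ℤ := AddMonoidHom.fst ℤ ℤ + AddMonoidHom.snd ℤ ℤ

/-- `totalDegree (p, q) = p + q`. [cite: Yokura2011MotivicCharacteristicClasses, §2 Rem. 2-9 (p. 386)] -/
theorem totalDegree_apply (pq : ℤ × ℤ) : totalDegree pq = pq.1 + pq.2 := rfl

/-- **The weight polynomial `P_W(X)(t) = E(X)(t, t) ∈ ℤ[t^{±1}] = ℤ[ℤ]`.** [cite: DeligneHodgeII1971, 2.3.1 and 2.3.7] [cite: Yokura2011MotivicCharacteristicClasses, §2 Rem. 2-9 (p. 386)] -/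
def weightPolynomial : AddMonoidAlgebra ℤ ℤ := (hodgePolynomial X).mapDomain totalDegree

/-- **`dim_ℚ Gr^W_k X = Σ_{p+q=k} h^{p,q}(X)`** (over the support of `E(X)`; `W_n H_ℂ = ⊕_{p+q≤n} I^{p,q}`). [cite: CattaniElZeinGriffithsLe2014, Prop. 3.2.19] -/
theorem finrank_grW_eq_sum_hodgeNumber (k : ℤ) :
    (Module.finrank ℚ (MixedHodgeStructure.grW X.str.W k) : ℤ) = ∑ pq ∈ (hodgePolynomial X).coeff.support with pq.1 + pq.2 = k, (X.str.hodgeNumber pq.1 pq.2 : ℤ) := by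
  classical
  set s := (hodgePolynomial X).coeff.support with hs_def
  have hs : ∀ pq, X.str.deligneFamily pq ≠ ⊥ → pq ∈ s := fun pq hpq => by
    refine Finsupp.mem_support_iff.2 fun h0 => hpq ?_
    rw [coeff_hodgePolynomial_apply, Nat.cast_eq_zero, ← MixedHodgeStructure.finrank_deligneI_eq_hodgeNumber, ← MixedHodgeStructure.deligneFamily_apply] at h0
    exact Submodule.finrank_eq_zero.1 h0
  -- `dim Gr^W_k = dim W_k − dim W_{k−1}`
  have h1 := Submodule.finrank_quotient_add_finrank (MixedHodgeStructure.subPiece X.str.W k)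
  have h2 : Module.finrank ℚ (MixedHodgeStructure.subPiece X.str.W k) = Module.finrank ℚ (X.str.W (k - 1)) :=
    LinearEquiv.finrank_eq (Submodule.submoduleOfEquivOfLe (X.str.monotone_W (show k - 1 ≤ k by omega)))
  have hk := X.str.finrank_W_eq_sum_hodgeNumber k s hs
  have hk1 := X.str.finrank_W_eq_sum_hodgeNumber (k - 1) s hs
  -- split `p + q ≤ k` into `p + q = k` and `p + q ≤ k − 1`
  have hsplit : (∑ pq ∈ s with pq.1 + pq.2 ≤ k, X.str.hodgeNumber pq.1 pq.2) =
      (∑ pq ∈ s with pq.1 + pq.2 = k, X.str.hodgeNumber pq.1 pq.2) + ∑ pq ∈ s with pq.1 + pq.2 ≤ k - 1, X.str.hodgeNumber pq.1 pq.2 := by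
    rw [Finset.sum_filter, Finset.sum_filter, Finset.sum_filter, ← Finset.sum_add_distrib]
    refine Finset.sum_congr rfl fun pq _ => ?_
    by_cases h : pq.1 + pq.2 = k
    · rw [if_pos h.le, if_pos h, if_neg (by omega), add_zero]
    · by_cases h' : pq.1 + pq.2 ≤ k - 1
      · rw [if_pos (by omega), if_neg h, if_pos h', zero_add]
      · rw [if_neg (by omega), if_neg h, if_neg h', add_zero]
  have hgr : Module.finrank ℚ (MixedHodgeStructure.grW X.str.W k) = ∑ pq ∈ s with pq.1 + pq.2 = k, X.str.hodgeNumber pq.1 pq.2 := by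
    change Module.finrank ℚ (↥(X.str.W k) ⧸ MixedHodgeStructure.subPiece X.str.W k) = _
    omega
  rw [hgr, Nat.cast_sum]

/-- **`[t^k] P_W(X) = dim_ℚ Gr^W_k X`.** [cite: DeligneHodgeII1971, 2.3.1] [cite: CattaniElZeinGriffithsLe2014, Prop. 3.2.19] -/
theorem coeff_weightPolynomial (k : ℤ) : (weightPolynomial X).coeff k = Module.finrank ℚ (MixedHodgeStructure.grW X.str.W k) := by
  classical
  rw [finrank_grW_eq_sum_hodgeNumber, weightPolynomial, AddMonoidAlgebra.mapDomain, AddMonoidAlgebra.coeff_ofCoeff, Finsupp.mapDomain, Finsupp.sum_apply,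
    Finsupp.sum, Finset.sum_filter]
  refine Finset.sum_congr rfl fun pq _ => ?_
  rw [Finsupp.single_apply, totalDegree_apply, coeff_hodgePolynomial_apply]

/-- **`P_W(X)(1) = Σ_k dim Gr^W_k X = dim_ℚ X`.** [cite: CattaniElZeinGriffithsLe2014, Prop. 3.2.19] -/
theorem sum_coeff_weightPolynomial : ((weightPolynomial X).coeff.sum fun _ n => n) = (Module.finrank ℚ X : ℤ) := by
  rw [← sum_coeff_hodgePolynomial X, weightPolynomial, AddMonoidAlgebra.mapDomain, AddMonoidAlgebra.coeff_ofCoeff]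
  exact Finsupp.sum_mapDomain_index_addMonoidHom fun _ => AddMonoidHom.id ℤ

/-! ## §2 Weights, `weightsIn`, purity -/

/-- **`k` is a weight of `X` iff `[t^k] P_W(X) ≠ 0`** (`Gr^W_k X ≠ 0`). [cite: DeligneHodgeII1971, 2.3.1 and 2.3.7] -/
theorem isWeight_iff_coeff_weightPolynomial_ne_zero (k : ℤ) : X.str.IsWeight k ↔ (weightPolynomial X).coeff k ≠ 0 := by
  rw [coeff_weightPolynomial, Nat.cast_ne_zero, MixedHodgeStructure.IsWeight]
  have hle : X.str.W (k - 1) ≤ X.str.W k := X.str.monotone_W (show k - 1 ≤ k by omega)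
  have h1 := Submodule.finrank_quotient_add_finrank (MixedHodgeStructure.subPiece X.str.W k)
  have h2 : Module.finrank ℚ (MixedHodgeStructure.subPiece X.str.W k) = Module.finrank ℚ (X.str.W (k - 1)) :=
    LinearEquiv.finrank_eq (Submodule.submoduleOfEquivOfLe hle)
  change _ ↔ Module.finrank ℚ (↥(X.str.W k) ⧸ MixedHodgeStructure.subPiece X.str.W k) ≠ 0
  constructor
  · intro hlt h0
    have := Submodule.finrank_lt_finrank_of_lt hlt
    omega
  · intro h0
    refine lt_of_le_of_ne hle fun heq => h0 ?_
    have : Module.finrank ℚ (X.str.W (k - 1)) = Module.finrank ℚ (X.str.W k) := by rw [heq]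
    omega

/-- **`X` has weights in `S` iff `P_W(X)` is supported in `S`.** [cite: CattaniElZeinGriffithsLe2014, Cor. 3.2.33] [cite: DeligneHodgeII1971, 2.3.7] -/
theorem weightsIn_iff_support_weightPolynomial_subset (S : Set ℤ) : weightsIn S X ↔ ↑(weightPolynomial X).coeff.support ⊆ S := by
  rw [weightsIn_iff]
  constructor
  · intro h k hk
    exact h ((isWeight_iff_coeff_weightPolynomial_ne_zero X k).2 (Finsupp.mem_support_iff.1 (Finset.mem_coe.1 hk)))
  · intro h k hk
    exact h (Finset.mem_coe.2 (Finsupp.mem_support_iff.2 ((isWeight_iff_coeff_weightPolynomial_ne_zero X k).1 hk)))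

/-- **`X` is pure of weight `n` iff `P_W(X) = (dim X) · t^n`.** [cite: DeligneHodgeII1971, 2.3.7] [cite: CattaniElZeinGriffithsLe2014, Cor. 3.2.33] -/
theorem isPure_iff_weightPolynomial_eq_single (n : ℤ) : X.str.IsPure n ↔ weightPolynomial X = AddMonoidAlgebra.single n (Module.finrank ℚ X : ℤ) := by
  classical
  rw [← weightsIn_singleton_iff, weightsIn_iff_support_weightPolynomial_subset]
  constructor
  · intro h
    have hsingle : (weightPolynomial X).coeff = Finsupp.single n ((weightPolynomial X).coeff n) := by
      ext k
      by_cases hk : k = n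
      · rw [hk, Finsupp.single_eq_same]
      · rw [Finsupp.single_eq_of_ne hk]
        by_contra hne
        exact hk (h (Finset.mem_coe.2 (Finsupp.mem_support_iff.2 hne)))
    have hsum := sum_coeff_weightPolynomial X
    rw [hsingle, Finsupp.sum_single_index rfl] at hsum
    refine AddMonoidAlgebra.coeff_injective ?_
    rw [AddMonoidAlgebra.coeff_single, hsingle, hsum]
  · intro h
    rw [h, AddMonoidAlgebra.coeff_single]
    exact (Finset.coe_subset.2 Finsupp.support_single_subset).trans (by simp)

/-! ## §3 Additivity, multiplicativity, duals, twists, Tate objects -/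

variable {X Y} in
/-- `P_W` is an isomorphism invariant. [cite: DeligneHodgeII1971, 2.3.7] -/
theorem weightPolynomial_eq_of_iso (e : X ≅ Y) : weightPolynomial X = weightPolynomial Y := by
  rw [weightPolynomial, weightPolynomial, hodgePolynomial_eq_of_iso e]

/-- **`P_W` is additive on short exact sequences** (`dim Gr^W_k` is additive by strictness). [cite: CattaniElZeinGriffithsLe2014, Cor. 3.2.21 (ii)] -/
theorem weightPolynomial_eq_add_of_shortExact (S : ShortComplex MixedHodgeStructureCat.{u}) (hS : S.ShortExact) [Module.Finite ℚ S.X₁] [Module.Finite ℚ S.X₂]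
    [Module.Finite ℚ S.X₃] : weightPolynomial S.X₂ = weightPolynomial S.X₁ + weightPolynomial S.X₃ := by
  rw [weightPolynomial, weightPolynomial, weightPolynomial, hodgePolynomial_eq_add_of_shortExact S hS, AddMonoidAlgebra.mapDomain_add]

/-- **`P_W(X ⊗ Y) = P_W(X) · P_W(Y)`** — the weights of a tensor product add, with multiplicities. [cite: DeligneHodgeII1971, 1.1.12] [cite: CattaniElZeinGriffithsLe2014, §3.2.2.7] -/
theorem weightPolynomial_tensorObj : weightPolynomial (tensorObj X Y) = weightPolynomial X * weightPolynomial Y := by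
  rw [weightPolynomial, weightPolynomial, weightPolynomial, hodgePolynomial_tensorObj, AddMonoidAlgebra.mapDomain_mul]

/-- `P_W(ℚ(0)) = 1`. [cite: DeligneHodgeII1971, 2.1.13] -/
theorem weightPolynomial_unitObj : weightPolynomial unitObj.{u} = 1 := by
  rw [weightPolynomial, hodgePolynomial_unitObj, AddMonoidAlgebra.mapDomain_one]

/-- **`P_W(X^∨)(t) = P_W(X)(t⁻¹)`** (`Gr^W_k(X^∨) ≅ (Gr^W_{−k} X)^∨`). [cite: DeligneHodgeII1971, 1.1.6] [cite: CattaniElZeinGriffithsLe2014, §3.2.2.7] -/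
theorem weightPolynomial_dual : weightPolynomial (of X.str.dual) = (weightPolynomial X).mapDomain (fun k : ℤ => -k) := by
  rw [weightPolynomial, weightPolynomial, hodgePolynomial_dual]
  refine AddMonoidAlgebra.coeff_injective ?_
  simp only [AddMonoidAlgebra.mapDomain, AddMonoidAlgebra.coeff_ofCoeff, ← Finsupp.mapDomain_comp]
  congr 1
  funext pq
  simp only [Function.comp_apply, totalDegree_apply, Prod.fst_neg, Prod.snd_neg, neg_add]

/-- **`P_W(X(j)) = t^{−2j} · P_W(X)`** (`W_k X(j) = W_{k+2j} X`). [cite: DeligneHodgeII1971, 2.1.13] [cite: CattaniElZeinGriffithsLe2014, Ex. 3.2.23 (4)] -/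
theorem weightPolynomial_tateTwist (j : ℤ) : weightPolynomial (of (X.str.tateTwist j)) = AddMonoidAlgebra.single (-2 * j) 1 * weightPolynomial X := by
  rw [weightPolynomial, weightPolynomial, hodgePolynomial_tateTwist, AddMonoidAlgebra.mapDomain_mul, AddMonoidAlgebra.mapDomain_single, totalDegree_apply]
  congr 2
  ring

/-- **`P_W(ℚ(j)) = t^{−2j}`.** [cite: DeligneHodgeII1971, 2.1.13] -/
theorem weightPolynomial_tateObj (j : ℤ) : haveI := finite_tateObj.{u} j; weightPolynomial (tateObj.{u} j) = AddMonoidAlgebra.single (-2 * j) 1 := by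
  rw [weightPolynomial, hodgePolynomial_tateObj, AddMonoidAlgebra.mapDomain_single, totalDegree_apply]
  congr 1
  ring

/-! ## §4 The Hodge–Deligne polynomial along the weight filtration -/

/-- **`E(W_k X)` is the part `p + q ≤ k` of `E(X)`.** [cite: CattaniElZeinGriffithsLe2014, Prop. 3.2.19 and Cor. 3.2.21 (ii)] -/
theorem coeff_hodgePolynomial_weightFunctor_obj (k : ℤ) (pq : ℤ × ℤ) :
    haveI : Module.Finite ℚ ((weightFunctor k).obj X) := inferInstanceAs (Module.Finite ℚ ↥(X.str.W k))
    (hodgePolynomial ((weightFunctor k).obj X)).coeff pq = if pq.1 + pq.2 ≤ k then (hodgePolynomial X).coeff pq else 0 := by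
  rw [coeff_hodgePolynomial_apply, coeff_hodgePolynomial_apply, hodgeNumber_weightFunctor_obj, Nat.cast_ite, Nat.cast_zero]

/-- **`E(X / W_k X)` is the part `p + q > k` of `E(X)`.** [cite: CattaniElZeinGriffithsLe2014, Cor. 3.2.21 (ii)] -/
theorem coeff_hodgePolynomial_weightQuotFunctor_obj (k : ℤ) (pq : ℤ × ℤ) :
    haveI : Module.Finite ℚ ((weightQuotFunctor k).obj X) := inferInstanceAs (Module.Finite ℚ (↥X ⧸ X.str.W k))
    (hodgePolynomial ((weightQuotFunctor k).obj X)).coeff pq = if k < pq.1 + pq.2 then (hodgePolynomial X).coeff pq else 0 := by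
  rw [coeff_hodgePolynomial_apply, coeff_hodgePolynomial_apply, hodgeNumber_weightQuotFunctor_obj, Nat.cast_ite, Nat.cast_zero]

/-- **`E(W_k X) + E(X / W_k X) = E(X)`.** [cite: CattaniElZeinGriffithsLe2014, Cor. 3.2.21 (ii)] -/
theorem hodgePolynomial_weightFunctor_obj_add_weightQuotFunctor_obj (k : ℤ) :
    haveI : Module.Finite ℚ ((weightFunctor k).obj X) := inferInstanceAs (Module.Finite ℚ ↥(X.str.W k))
    haveI : Module.Finite ℚ ((weightQuotFunctor k).obj X) := inferInstanceAs (Module.Finite ℚ (↥X ⧸ X.str.W k))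
    hodgePolynomial ((weightFunctor k).obj X) + hodgePolynomial ((weightQuotFunctor k).obj X) = hodgePolynomial X := by
  refine AddMonoidAlgebra.coeff_injective (Finsupp.ext fun pq => ?_)
  rw [AddMonoidAlgebra.coeff_add, Finsupp.add_apply, coeff_hodgePolynomial_weightFunctor_obj, coeff_hodgePolynomial_weightQuotFunctor_obj]
  by_cases h : pq.1 + pq.2 ≤ k
  · rw [if_pos h, if_neg (not_lt.2 h), add_zero]
  · rw [if_neg h, if_pos (not_le.1 h), zero_add]

/-- **`E(⊕_{k ∈ s} Gr^W_k X) = E(X)`** when `s` contains the weights of `X`: the Hodge–Deligne polynomial only sees the associated weight-graded object.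
[cite: CattaniElZeinGriffithsLe2014, §3.2.2.6 and Cor. 3.2.21 (ii)] [cite: DeligneHodgeII1971, 2.3.7] -/
theorem hodgePolynomial_grTotal_obj [HasFiniteBiproducts MixedHodgeStructureCat.{u}] [∀ n : ℤ, HasFiniteBiproducts (HodgeStructureCat.{u} n)] (s : Finset ℤ)
    (hs : weightsIn (↑s : Set ℤ) X) : haveI := finite_grTotal_obj s X; hodgePolynomial ((grTotal s).obj X) = hodgePolynomial X := by
  haveI := finite_grTotal_obj s X
  refine AddMonoidAlgebra.coeff_injective (Finsupp.ext fun pq => ?_)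
  rw [coeff_hodgePolynomial_apply, coeff_hodgePolynomial_apply, hodgeNumber_grTotal_obj_of_subset s (fun j hj => Finset.mem_coe.1 (hs hj))]

/-- `P_W(⊕_{k ∈ s} Gr^W_k X) = P_W(X)` when `s` contains the weights of `X`. [cite: DeligneHodgeII1971, 2.3.7] -/
theorem weightPolynomial_grTotal_obj [HasFiniteBiproducts MixedHodgeStructureCat.{u}] [∀ n : ℤ, HasFiniteBiproducts (HodgeStructureCat.{u} n)] (s : Finset ℤ)
    (hs : weightsIn (↑s : Set ℤ) X) : haveI := finite_grTotal_obj s X; weightPolynomial ((grTotal s).obj X) = weightPolynomial X := by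
  haveI := finite_grTotal_obj s X
  rw [weightPolynomial, weightPolynomial, hodgePolynomial_grTotal_obj X s hs]

end MixedHodgeStructureCat

end Literature.AlgebraicGeometry.Motives
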